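import Mathlib
import HarnessLib
import Literature.MathematicalPhysics.QuantumLattice.GrassmannSourceGrading
import Summits.HubbardSuperconductivity.HubbardSuperconductivity.Theorems.KLProgrammeKLRegimeEngineWtBudget

/-!
# Route `KLProgramme` — crux K3, VL child `KLRegimeVolumeLimitV17F2` (stmt-HubbardSuperconductivity-20440), located risk #8 «(VL)-DEAD-LEG»:
# TOKEN #24 «SRC2» — the SOURCE-SECTOR PROFILES of the scale-`n` action (the Defs text, plan g19 (R59u)/(R59aa)/(R59ac), pen (R66)/(R67); typer k3c4-p1
# g10/g11, co-typer k3c5-p3 g10/g11 (XREAD KL STATUS l.3813); producer's object word E1 r2d-p2 g8 l.3815 (D): AMPUTATED, read-out of record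
# `sourceProfilesAt_of_towerSrcLevels … → SourceProfilesAt L M (fun s m => klSrcCE P R ^ s * klWtBudget P Q U n m) … (K_n) n`, owner-designate T+)

The VL stub `stub_vl_nestedFramed` reads the FULL last-scale two-leg kernel, at every `(ω, k⃗)`; the in-band tower (b) and its currency
`KernelNormsWt4` (`klWtPinnedSum`: every leg analysed by the scale-`n` anisotropic family `klAnisoFamily … n`, BGM 2006 (2.70)) see no leg outside the
scale-`n` ball (`…LastScaleSectorsVanish`).  Repair of record (α)-AUGMENTED ≡ (R-src) (BGM 2006 §2.9: the external-field sector (4.3)–(4.8)): carry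
≤ 2 PLAIN («source») legs through the flow.  In the AMPUTATED organisation the scale-`n` object is the **doubled-analysed action**
`klSrcAction … n := map (toLin' [E_n on copy 0; E_plain on copy 1]) 𝒱⁽ⁿ⁾` (`GrassmannSpectatorReadout`: «external legs are never sectorised, internal lines are»;
`E_n = sectorAnalysisMatrix … (klAnisoFamily … n)`, `E_plain = sectorAnalysisMatrix … trivialMultiplier`) on the label type
`(SpaceTimeIdx × SectorLeg (sectorCount n)) × Fin 2` (copy 0 alive/analysed, copy 1 plain/source in sector slot 0 — k3c5-p3's `Γ × Fin 2` convention); its kernels with NO source leg are the kernels of `map (toLin' E_n) 𝒱⁽ⁿ⁾`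
((b)'s object), its kernels with `s ∈ {1,2}` source legs are the «kernels of `𝒱⁽ⁿ⁾` with `s` plain legs, rest sectorised at `n`» of token #24
(k3c5-p3's «KernelNormsExt»; consumer route by name: the source-graded step `…TwoVolumeSourceGradedStep.sum_norm_kernel_effAction_lowSource_le` (p566327) /
`Literature/…/GrassmannSourceGradedStep.sum_norm_kernel_effAction_srcGraded_le_of_gramBounded` (p568305), the per-scale lemma `…TwoVolumeSourceProfileScale`
(p568466), the truncation `GrassmannSourceGrading.srcTrunc` (p566122), the doubled tower step `…TwoVolumeDoubledTowerStep` (p569473)).  The token asserts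
NO SMALLNESS of the source sector (the source sector is removed from every step's convergence condition by exact rescaling); the consumer needs only
L-FREE budgets with an L-free WEIGHTED degree sum at the next step's input weight (k3c5-p3 rider (R1)) — hence the geometric-envelope form
`SourceProfilesGeomAt` below, whose ratio `r` the producer chooses and the assembler caps.  This file states, in (b)'s own currency (`imagTimeWeight`, `klScaleWt`, `latticeLegPos`; `srcCount` of
`Literature/…/GrassmannSourceGrading`):

* `klSrcAnalysis`, **`klSrcAction`** — the doubled analysis matrix and the doubled-analysed scale-`n` action;
* `srcLegPos` — positions of the legs of the doubled algebra (both copies live on the `2M`-lattice);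
* **`klSrcPinnedSum … n s m q w`** — the SOURCE-GRADED weighted pinned sum: degree `m`, exactly `s` source legs, leg `q` pinned at the field index `w`,
  every other leg summed over positions, labels AND copies, tree weight `klScaleWt_n` of the position image (= `klWtPinnedSum`'s format);
* **`SourceProfilesAt S … n`** := `∀ s ∈ {1,2}, ∀ m q w, klSrcPinnedSum … n s m q w ≤ S s m` — TOKEN #24 with an ABSTRACT graded budget
  `S : ℕ → ℕ → ℝ` (the VL consumer needs only: `S` independent of `L` above a threshold and finite at each of the `nScales β + 1` scales; the budget
  TERM is the producer's — pen (R59u)(ii));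
* `SourceProfilesGeomAt B r … n` — the geometric-envelope form `≤ B s · r^m` (rider (R1): what makes the weighted degree sum of the next step L-free);
* **`klSrcBudget P Q U A j s m`** := `A j s · (if m ≤ 2 then 1 else klWtBudget P Q U j m)` — the budget of the v9 producer stub: FREE L-free constants
  `A j s` in the two degree-`≤ 2` families (the END read-out's row bound), and (b)'s OWN degree law `klWtBudget P Q U j m` (`…EngineWtBudget`) in every
  degree `m ≥ 3` — so that the consumer's summability against the two-volume step's weight is the SAME condition it already owes for the in-band
  profile (b) (no new interface number; rider (R1)'s cap realised by (b)'s ratio);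
* bookkeeping: `klSrcPinnedSum_nonneg`, `SourceProfilesAt.mono`, `sourceProfilesAt_of_forall`, `SourceProfilesGeomAt.sourceProfilesAt`.

§ FAMILY-DECOUPLED CARRIERS (appended, k3c4-p1 g12, located point «(VL)-SUBDIAG-READOUT», KL STATUS 2026-08-27 23:48Z).  The two-volume step integrates the
slice `C^K_{(Λ_{n+1},Λ_n]}`, which lies in the plateau `{t ≤ Λ_n}` of the family `F_{n−1}` and NOT in that of `F_n` (`sum_klAnisoFamily_eq_one_of_blockSliceCT_ne_zero`,
E1's block-step convention `…EngineTowerBlockStepWt` §1); the doubled tower therefore analyses `𝒱⁽ⁿ⁾` with the alive family ONE LEVEL COARSER, and the consumer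
reads the source profiles of `[E(F_J) | E_plain]·𝒱⁽ⁿ⁾` with `J = n − 1`.  Hence the carriers with the alive FAMILY index `J`, the tree-weight RATE index `r`
and the ACTION index `n` decoupled (E1's `klWtPinnedSumAt` convention, `…EngineTowerModelDefsRate`): `klSrcAnalysisAt … J`, **`klSrcActionAt … J n`**,
**`klSrcPinnedSumAt … J r n s m q w`**, **`SourceProfilesAtLev S … J r n`**; at `J = r = n` they ARE the carriers above (`rfl` rows).

Definitions + bookkeeping only; nothing about the model's sizes is asserted.  References: BGM 2006 §2.7 (2.70)–(2.71), §2.9 (4.3)–(4.8).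
-/

noncomputable section

namespace Summit.HubbardSuperconductivity.HubbardSuperconductivity.Theorems.TwoVolumeSource

set_option linter.dupNamespace false -- summit = problem name (single-conjunct summit), D-0017

open Real Finset Literature.MathematicalPhysics.QuantumLattice Literature.Probability.LatticeModels GrassmannAlgebra
open Summit.HubbardSuperconductivity.HubbardSuperconductivity.Theorems.KLProgrammeLegKernels
open Summit.HubbardSuperconductivity.HubbardSuperconductivity.Theorems.KLRegimeSplit
open Summit.HubbardSuperconductivity.HubbardSuperconductivity.Theorems.EngineV8

variable (L M : ℕ) [NeZero L]

/-- The label type of the doubled algebra at scale `n` (k3c5-p3's `Γ × Fin 2` convention of `…TwoVolumeSpectatorLegs`): copy `0` = alive sector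
fields of the scale-`n` anisotropic family, copy `1` = plain («source») space-time fields, carried in the sector slot `0` (the other sector slots of
copy `1` are dead: the analysis matrix vanishes there). -/
abbrev SrcLabel (n : ℕ) : Type := (SpaceTimeIdx L M × SectorLeg (sectorCount n)) × Fin 2

/-- **The doubled analysis matrix** at scale `n` in the frame `K`: copy `0` ↦ `E_n = sectorAnalysisMatrix … (klAnisoFamily … n)` (BGM 2006 (2.70)),
copy `1`, sector slot `0` ↦ `E_plain = sectorAnalysisMatrix … trivialMultiplier` (the plain position-space field, §2.9's external leg), copy `1`,
other sector slots ↦ `0`. -/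
def klSrcAnalysis (β μ : ℝ) (K : TrigPolyC4v) (n : ℕ) : Matrix (SrcLabel L M n) (HubbardFieldIdx L M) ℂ :=
  Matrix.of fun Y X => if Y.2 = 0 then sectorAnalysisMatrix L M β (klAnisoFamily L M β μ K klE0 n) Y.1 X
    else if (Y.1.2.1.1 : ℕ) = 0 then sectorAnalysisMatrix L M β (trivialMultiplier L M) (Y.1.1, (((0 : Fin 1), Y.1.2.1.2), Y.1.2.2)) X else 0

/-- **The doubled-analysed scale-`n` action** `map (toLin' klSrcAnalysis) 𝒱⁽ⁿ⁾` (the amputated form of BGM 2006 §2.9's `𝒱⁽ⁿ⁾ + ℬ⁽ⁿ⁾ + W_R`: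
every leg either analysed at scale `n` (copy `0`) or plain (copy `1`)). -/
def klSrcAction (β U μ : ℝ) (K : TrigPolyC4v) (n : ℕ) : GrassmannAlgebra ℂ (SrcLabel L M n) :=
  ExteriorAlgebra.map (Matrix.toLin' (klSrcAnalysis L M β μ K n)) (klEffectiveAction L M β U μ K klE0 n)

/-- The position of a leg of the doubled algebra inside the `Ng`-point grid bookkeeping (both copies live on the `2M`-lattice). -/
def srcLegPos (Ng : ℕ) {N : ℕ} : (SpaceTimeIdx L M × SectorLeg N) × Fin 2 → ZMod Ng × TorusSite 2 L := fun Y => latticeLegPos Ng Y.1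

/-- **The source-graded weighted pinned sum** of the doubled-analysed scale-`n` action: degree `m`, exactly `s` source legs, leg `q` pinned at `w`:
`ε_x^{m−1} · Σ_{X : X q = w, srcCount (copy = 1) X = s} klScaleWt_n(positions of X) · ‖kernel (klSrcAction … n) m X‖` (the format of `klWtPinnedSum`). -/
def klSrcPinnedSum (β U μ : ℝ) (K : TrigPolyC4v) (n s m : ℕ) (q : Fin m) (w : SrcLabel L M n) : ℝ :=
  imagTimeWeight β M ^ (m - 1) *
    ∑ X ∈ univ.filter (fun X : Fin m → SrcLabel L M n => X q = w ∧ srcCount (fun Y : SrcLabel L M n => Y.2 = 1) X = s),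
      klScaleWt L M β n ((univ.image X).image (srcLegPos L M (2 * (2 * M)))) * ‖kernel ℂ (klSrcAction L M β U μ K n) m X‖

/-- Unfolding `klSrcPinnedSum`. -/
theorem klSrcPinnedSum_def (β U μ : ℝ) (K : TrigPolyC4v) (n s m : ℕ) (q : Fin m) (w : SrcLabel L M n) :
    klSrcPinnedSum L M β U μ K n s m q w = imagTimeWeight β M ^ (m - 1) *
      ∑ X ∈ univ.filter (fun X : Fin m → SrcLabel L M n => X q = w ∧ srcCount (fun Y : SrcLabel L M n => Y.2 = 1) X = s),
        klScaleWt L M β n ((univ.image X).image (srcLegPos L M (2 * (2 * M)))) * ‖kernel ℂ (klSrcAction L M β U μ K n) m X‖ := rfl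

/-- `0 ≤ klSrcPinnedSum` (`β ≥ 0`). -/
theorem klSrcPinnedSum_nonneg {β : ℝ} (hβ : 0 ≤ β) (U μ : ℝ) (K : TrigPolyC4v) (n s m : ℕ) (q : Fin m) (w : SrcLabel L M n) :
    0 ≤ klSrcPinnedSum L M β U μ K n s m q w :=
  mul_nonneg (pow_nonneg (imagTimeWeight_nonneg hβ M) _)
    (sum_nonneg fun _ _ => mul_nonneg (zero_le_one.trans (one_le_klScaleWt L M β n _)) (norm_nonneg _))

/-- **TOKEN #24 «SRC2» — `SourceProfilesAt S … n`**: the scale-`n` source-sector profiles of the frame `K` with one and two source legs are within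
the graded budget `S s m`, in every degree `m`, at every pin. -/
def SourceProfilesAt (S : ℕ → ℕ → ℝ) (β U μ : ℝ) (K : TrigPolyC4v) (n : ℕ) : Prop :=
  ∀ (s : ℕ), 1 ≤ s → s ≤ 2 → ∀ (m : ℕ) (q : Fin m) (w : SrcLabel L M n), klSrcPinnedSum L M β U μ K n s m q w ≤ S s m

/-- **TOKEN #24, geometric-envelope form (rider (R1))** — `SourceProfilesGeomAt B r … n`: the source-sector profiles with one and two source legs are within
`B s · r ^ m` in every degree `m`, at every pin (`B`, `r` L-free, producer-chosen; the assembler's v9 stub caps `r` by the next step's admissible ratio; NO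
smallness of `B` is asserted or needed). -/
def SourceProfilesGeomAt (B : ℕ → ℝ) (r : ℝ) (β U μ : ℝ) (K : TrigPolyC4v) (n : ℕ) : Prop :=
  ∀ (s : ℕ), 1 ≤ s → s ≤ 2 → ∀ (m : ℕ) (q : Fin m) (w : SrcLabel L M n), klSrcPinnedSum L M β U μ K n s m q w ≤ B s * r ^ m

variable {L M}

/-- The geometric-envelope form is a `SourceProfilesAt` with the budget `S s m = B s · r^m`. -/
theorem SourceProfilesGeomAt.sourceProfilesAt {B : ℕ → ℝ} {r β U μ : ℝ} {K : TrigPolyC4v} {n : ℕ} (h : SourceProfilesGeomAt L M B r β U μ K n) :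
    SourceProfilesAt L M (fun s m => B s * r ^ m) β U μ K n := h

/-- Intro form. -/
theorem sourceProfilesAt_of_forall {S : ℕ → ℕ → ℝ} {β U μ : ℝ} {K : TrigPolyC4v} {n : ℕ}
    (h : ∀ (s : ℕ), 1 ≤ s → s ≤ 2 → ∀ (m : ℕ) (q : Fin m) (w : SrcLabel L M n), klSrcPinnedSum L M β U μ K n s m q w ≤ S s m) :
    SourceProfilesAt L M S β U μ K n := h

/-- A larger budget is still met. -/
theorem SourceProfilesAt.mono {S S' : ℕ → ℕ → ℝ} {β U μ : ℝ} {K : TrigPolyC4v} {n : ℕ} (h : SourceProfilesAt L M S β U μ K n)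
    (hSS' : ∀ s m, S s m ≤ S' s m) : SourceProfilesAt L M S' β U μ K n :=
  fun s hs hs2 m q w => (h s hs hs2 m q w).trans (hSS' s m)

/-- The one-source-leg clause. -/
theorem SourceProfilesAt.one {S : ℕ → ℕ → ℝ} {β U μ : ℝ} {K : TrigPolyC4v} {n : ℕ} (h : SourceProfilesAt L M S β U μ K n)
    (m : ℕ) (q : Fin m) (w : SrcLabel L M n) : klSrcPinnedSum L M β U μ K n 1 m q w ≤ S 1 m :=
  h 1 le_rfl (by norm_num) m q w

/-- The two-source-leg clause. -/
theorem SourceProfilesAt.two {S : ℕ → ℕ → ℝ} {β U μ : ℝ} {K : TrigPolyC4v} {n : ℕ} (h : SourceProfilesAt L M S β U μ K n)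
    (m : ℕ) (q : Fin m) (w : SrcLabel L M n) : klSrcPinnedSum L M β U μ K n 2 m q w ≤ S 2 m :=
  h 2 (by norm_num) le_rfl m q w

/-! ### The budget of the v9 producer stub: free in degree `≤ 2`, (b)'s degree law above -/

/-- **`klSrcBudget P Q U A j s m`** — the source-profile budget of skeleton v9's producer stub: `A j s` (free, L-free) in the degree-`≤ 2` families,
`A j s · klWtBudget P Q U j m` ((b)'s own degree law, `…EngineWtBudget`) in every degree `m ≥ 3`. -/
def klSrcBudget (P : SplitConsts) (Q : EngConsts) (U : ℝ) (A : ℕ → ℕ → ℝ) (j s m : ℕ) : ℝ :=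
  A j s * (if m ≤ 2 then 1 else klWtBudget P Q U j m)

/-- Unfolding `klSrcBudget` in degree `≤ 2`. -/
theorem klSrcBudget_of_le_two (P : SplitConsts) (Q : EngConsts) (U : ℝ) (A : ℕ → ℕ → ℝ) (j s : ℕ) {m : ℕ} (hm : m ≤ 2) :
    klSrcBudget P Q U A j s m = A j s := by
  rw [klSrcBudget, if_pos hm, mul_one]

/-- Unfolding `klSrcBudget` in degree `≥ 3`. -/
theorem klSrcBudget_of_two_lt (P : SplitConsts) (Q : EngConsts) (U : ℝ) (A : ℕ → ℕ → ℝ) (j s : ℕ) {m : ℕ} (hm : 2 < m) :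
    klSrcBudget P Q U A j s m = A j s * klWtBudget P Q U j m := by
  rw [klSrcBudget, if_neg (not_le.2 hm)]

/-- The budget is nonnegative (`0 ≤ A j s`, `0 ≤ CE`, `0 ≤ Klam`). -/
theorem klSrcBudget_nonneg {P : SplitConsts} {Q : EngConsts} (hCE : 0 ≤ Q.CE) (hK : 0 ≤ P.Klam) (U : ℝ) {A : ℕ → ℕ → ℝ}
    (hA : ∀ j s, 0 ≤ A j s) (j s m : ℕ) : 0 ≤ klSrcBudget P Q U A j s m := by
  unfold klSrcBudget
  refine mul_nonneg (hA j s) ?_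
  split_ifs
  · exact zero_le_one
  · exact klWtBudget_nonneg hCE hK U j m

/-! ### Family-decoupled carriers: alive family `F_J`, tree-weight rate `r`, action `𝒱⁽ⁿ⁾` (the sub-diagonal read-out `J = n − 1` of the VL step) -/

variable (L M)

/-- **The doubled analysis matrix with the alive family `F_J`** (copy `0` ↦ `E(F_J)`, copy `1`, sector slot `0` ↦ `E_plain`, other slots ↦ `0`); at `J = n` it is
`klSrcAnalysis … n`. -/
def klSrcAnalysisAt (β μ : ℝ) (K : TrigPolyC4v) (J : ℕ) : Matrix (SrcLabel L M J) (HubbardFieldIdx L M) ℂ :=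
  Matrix.of fun Y X => if Y.2 = 0 then sectorAnalysisMatrix L M β (klAnisoFamily L M β μ K klE0 J) Y.1 X
    else if (Y.1.2.1.1 : ℕ) = 0 then sectorAnalysisMatrix L M β (trivialMultiplier L M) (Y.1.1, (((0 : Fin 1), Y.1.2.1.2), Y.1.2.2)) X else 0

/-- **The doubled-analysed scale-`n` action with the alive family `F_J`**: `map (toLin' (klSrcAnalysisAt … J)) 𝒱⁽ⁿ⁾` (the VL tower reads `J = n − 1`:
the slice `(Λ_{n+1}, Λ_n]` lies in the plateau of `F_{n−1}`). -/
def klSrcActionAt (β U μ : ℝ) (K : TrigPolyC4v) (J n : ℕ) : GrassmannAlgebra ℂ (SrcLabel L M J) :=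
  ExteriorAlgebra.map (Matrix.toLin' (klSrcAnalysisAt L M β μ K J)) (klEffectiveAction L M β U μ K klE0 n)

/-- **The source-graded weighted pinned sum, family `F_J`, rate `r`, action `𝒱⁽ⁿ⁾`**: degree `m`, exactly `s` source legs, leg `q` pinned at `w`, tree weight
`klScaleWt … r` of the position image (E1's rate-decoupled convention `klWtPinnedSumAt`). -/
def klSrcPinnedSumAt (β U μ : ℝ) (K : TrigPolyC4v) (J r n s m : ℕ) (q : Fin m) (w : SrcLabel L M J) : ℝ :=
  imagTimeWeight β M ^ (m - 1) *
    ∑ X ∈ univ.filter (fun X : Fin m → SrcLabel L M J => X q = w ∧ srcCount (fun Y : SrcLabel L M J => Y.2 = 1) X = s),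
      klScaleWt L M β r ((univ.image X).image (srcLegPos L M (2 * (2 * M)))) * ‖kernel ℂ (klSrcActionAt L M β U μ K J n) m X‖

/-- **`SourceProfilesAtLev S … J r n`** — the source-sector profiles (one and two source legs) of `𝒱⁽ⁿ⁾` analysed at the alive family `F_J`, weighed at rate
`r`, within the graded budget `S s m`: the family-decoupled form of TOKEN #24 (the VL consumer reads `J = n − 1`). -/
def SourceProfilesAtLev (S : ℕ → ℕ → ℝ) (β U μ : ℝ) (K : TrigPolyC4v) (J r n : ℕ) : Prop :=
  ∀ (s : ℕ), 1 ≤ s → s ≤ 2 → ∀ (m : ℕ) (q : Fin m) (w : SrcLabel L M J), klSrcPinnedSumAt L M β U μ K J r n s m q w ≤ S s m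

variable {L M}

omit [NeZero L] in
/-- At `J = n` the decoupled analysis IS `klSrcAnalysis` (`rfl`). -/
theorem klSrcAnalysisAt_self (β μ : ℝ) (K : TrigPolyC4v) (n : ℕ) : klSrcAnalysisAt L M β μ K n = klSrcAnalysis L M β μ K n := rfl

/-- At `J = n` the decoupled action IS `klSrcAction` (`rfl`). -/
theorem klSrcActionAt_self (β U μ : ℝ) (K : TrigPolyC4v) (n : ℕ) : klSrcActionAt L M β U μ K n n = klSrcAction L M β U μ K n := rfl

/-- At `J = r = n` the decoupled pinned sum IS `klSrcPinnedSum` (`rfl`). -/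
theorem klSrcPinnedSumAt_self (β U μ : ℝ) (K : TrigPolyC4v) (n s m : ℕ) (q : Fin m) (w : SrcLabel L M n) :
    klSrcPinnedSumAt L M β U μ K n n n s m q w = klSrcPinnedSum L M β U μ K n s m q w := rfl

/-- At `J = r = n` the decoupled token IS `SourceProfilesAt` (`Iff.rfl`). -/
theorem sourceProfilesAtLev_self_iff (S : ℕ → ℕ → ℝ) (β U μ : ℝ) (K : TrigPolyC4v) (n : ℕ) :
    SourceProfilesAtLev L M S β U μ K n n n ↔ SourceProfilesAt L M S β U μ K n := Iff.rfl

/-- Unfolding `klSrcPinnedSumAt`. -/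
theorem klSrcPinnedSumAt_def (β U μ : ℝ) (K : TrigPolyC4v) (J r n s m : ℕ) (q : Fin m) (w : SrcLabel L M J) :
    klSrcPinnedSumAt L M β U μ K J r n s m q w = imagTimeWeight β M ^ (m - 1) *
      ∑ X ∈ univ.filter (fun X : Fin m → SrcLabel L M J => X q = w ∧ srcCount (fun Y : SrcLabel L M J => Y.2 = 1) X = s),
        klScaleWt L M β r ((univ.image X).image (srcLegPos L M (2 * (2 * M)))) * ‖kernel ℂ (klSrcActionAt L M β U μ K J n) m X‖ := rfl

/-- `0 ≤ klSrcPinnedSumAt` (`β ≥ 0`). -/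
theorem klSrcPinnedSumAt_nonneg {β : ℝ} (hβ : 0 ≤ β) (U μ : ℝ) (K : TrigPolyC4v) (J r n s m : ℕ) (q : Fin m) (w : SrcLabel L M J) :
    0 ≤ klSrcPinnedSumAt L M β U μ K J r n s m q w :=
  mul_nonneg (pow_nonneg (imagTimeWeight_nonneg hβ M) _)
    (sum_nonneg fun _ _ => mul_nonneg (zero_le_one.trans (one_le_klScaleWt L M β r _)) (norm_nonneg _))

/-- Intro form. -/
theorem sourceProfilesAtLev_of_forall {S : ℕ → ℕ → ℝ} {β U μ : ℝ} {K : TrigPolyC4v} {J r n : ℕ}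
    (h : ∀ (s : ℕ), 1 ≤ s → s ≤ 2 → ∀ (m : ℕ) (q : Fin m) (w : SrcLabel L M J), klSrcPinnedSumAt L M β U μ K J r n s m q w ≤ S s m) :
    SourceProfilesAtLev L M S β U μ K J r n := h

/-- A larger budget is still met. -/
theorem SourceProfilesAtLev.mono {S S' : ℕ → ℕ → ℝ} {β U μ : ℝ} {K : TrigPolyC4v} {J r n : ℕ} (h : SourceProfilesAtLev L M S β U μ K J r n)
    (hSS' : ∀ s m, S s m ≤ S' s m) : SourceProfilesAtLev L M S' β U μ K J r n :=
  fun s hs hs2 m q w => (h s hs hs2 m q w).trans (hSS' s m)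

/-- The one-source-leg clause. -/
theorem SourceProfilesAtLev.one {S : ℕ → ℕ → ℝ} {β U μ : ℝ} {K : TrigPolyC4v} {J r n : ℕ} (h : SourceProfilesAtLev L M S β U μ K J r n)
    (m : ℕ) (q : Fin m) (w : SrcLabel L M J) : klSrcPinnedSumAt L M β U μ K J r n 1 m q w ≤ S 1 m :=
  h 1 le_rfl (by norm_num) m q w

/-- The two-source-leg clause. -/
theorem SourceProfilesAtLev.two {S : ℕ → ℕ → ℝ} {β U μ : ℝ} {K : TrigPolyC4v} {J r n : ℕ} (h : SourceProfilesAtLev L M S β U μ K J r n)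
    (m : ℕ) (q : Fin m) (w : SrcLabel L M J) : klSrcPinnedSumAt L M β U μ K J r n 2 m q w ≤ S 2 m :=
  h 2 (by norm_num) le_rfl m q w

end Summit.HubbardSuperconductivity.HubbardSuperconductivity.Theorems.TwoVolumeSource

end
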